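/-
Copyright (c) 2026 the pub-hodgecm-mathlib formalisation cell (harness21).  Prover seat hodgecm-mathlib-K2E4-p10 (g6), Track B ∕ K2-LIT, h413 =
`stmt-HodgeConjecture-24833`, line `K2_E1_TraceFormulaBeta`, campaign «EIS-R7-BL-SPH-3», (RES) letter payers: the CONTINUED Hecke relation (Hk) and the CONTINUED constant term (E3′)
of the meromorphically continued spherical Eisenstein series on `U(2,1)` over a CM field, from the EXPORTS letters (E1)(E2)(E4) (dealer K2E1-plan (g6) (89)∕(98), 2026-09-04).
-/
import Summits.HodgeConjecture.HodgeConjecture.Theorems.K2E1SphericalEisensteinHeckeEigenU2                -- ★ ℓ9∕P5 (K2E1-p10): `hHecke_cm_three` (`R(h)E_z = ĥ(z)E_z` on the tube); brings `differentiable_integral_mul_borelHeight_cpow_cm`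
import Summits.HodgeConjecture.HodgeConjecture.Theorems.K2E1SphericalEisensteinContinuationU3Final         -- ★ (K2E3-p11 g9): `borelConstantTerm_sphericalEisenstein_cm_three` (the constant term on the tube)
import Summits.HodgeConjecture.HodgeConjecture.Theorems.K2LiuContinuedFamilyUnipotentIntegralsHolomorphic  -- ★ W3-a (K2Liu-p01 g7): `differentiableOn_integral_mul_family` (holomorphy of `s ↦ ∫ w·E s (a u)`, no derivative data)
import Mathlib.Analysis.Analytic.Uniqueness
import Mathlib.Analysis.Complex.CauchyIntegral
import HarnessLib

/-!
# K2·E1 — `K2E1ContinuedEisensteinHeckeConstantTermCMThree` ((RES) payers (Hk)∕(E3′) at `U(2,1)_{L/L⁺}`): THE HECKE RELATION `∫ h(y)Ẽ(z)(gy) dy = ĥ(z)Ẽ(z)(g)` AND THE CONSTANT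
# TERM `Ẽ(z)_B(g) = φ₀(H(g)^z + c̃(z)H(g)^{2−z})` OF THE CONTINUED EISENSTEIN SERIES HOLD ON THE WHOLE DOMAIN OF HOLOMORPHY, FOR EVERY `g`

Track B ∕ K2-LIT, crux h413 = `stmt-HodgeConjecture-24833`, route of record `HCCMUnconditional`; cell `hodgecm-mathlib`, squad K2, ENGINE E1, campaign EIS-R7-BL-SPH-3 (R31).  Prover seat
`hodgecm-mathlib-K2E4-p10` (g6); RE-KEY (89) + ruling (98) of the dealer K2E1-plan (g6) («(E3′)∕(Hk) follow downstream from (E1)(E2)(E4) + identity principle; payer K2E4-p10»).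
THEOREMS ONLY (no `def`, no `instance`, no notation, no named-fact hypothesis, no `sorry`); lane `--supports stmt-HodgeConjecture-24833 --as helper` (count-neutral).  Closes no socket.

THE MATHEMATICS ([MoeglinWaldspurger1995, IV.1.9–IV.1.11]; [Langlands1976, §6–§7]).  Let `Ẽ : D × G(𝔸) → ℂ` be the continued spherical Eisenstein values on an open preconnected `D ⊆ ℂ`
meeting the Godement tube in a neighbourhood of a real point `σ₀ > 2`, with (E1) `z ↦ Ẽ(z)(g)` holomorphic on `D` for each `g`, (E4) `Ẽ(z)` continuous for `z ∈ D`, (E2-bd) `Ẽ` locally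
bounded on `D × (compacts)`, and (E2) `Ẽ(z) = E(φ₀H^z)` on `D ∩ {2 < re}`.  An integral `∫ w(u)·Ẽ(z)(a(u)) dμ(u)` of the family against a compactly supported integrable weight is then
HOLOMORPHIC on `D` (★ `differentiableOn_integral_mul_family`: Cauchy estimates under the integral, no derivative data), so every identity between such integrals and holomorphic
multiples of `Ẽ(z)(g)` that holds on the tube persists on `D` (identity principle, Mathlib `AnalyticOnNhd.eqOn_zero_of_preconnected_of_eventuallyEq_zero`):
* §1 `differentiableOn_integral_mul_continued_cm_three` — `z ↦ ∫ h(y)Ẽ(z)(g y) dν_G(y)` is holomorphic on `D` (`h ∈ C_c`); `differentiableOn_borelConstantTerm_continued_cm_three` —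
  `z ↦ Ẽ(z)_B(g) = ν(𝓕)⁻¹∫_𝓕 Ẽ(z)(u g) dν(u)` is holomorphic on `D` (`𝓕` of compact closure).
* §2 **`integral_mul_continued_eq_cm_three`** ((Hk) continued) — `∫ h(y)·Ẽ(z)(g y) dν_G = ĥ(z)·Ẽ(z)(g)` for ALL `z ∈ D`, `g ∈ G(𝔸)` (`h` real, `K_U`-left-invariant `C_c`; tube case ★
  `hHecke_cm_three`, `ĥ` entire ★ `differentiable_integral_mul_borelHeight_cpow_cm`).
* §3 **`borelConstantTerm_continued_eq_cm_three`** ((E3′) continued) — `Ẽ(z)_B(g) = φ₀·(H(g)^z + c̃(z)·H(g)^{2−z})` for ALL `z ∈ D`, `g`, given the continued coefficient `c̃`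
  holomorphic on `D` with the tube identity `E(φ₀H^z)_B(g) = φ₀(H(g)^z + c̃(z)H(g)^{2−z})` ((E3), ★ `borelConstantTerm_sphericalEisenstein_cm_three` + the consumer's definition of `c̃`).
HONEST LABEL: HC_CM is proved only modulo the 7 printed citations (2 remaining named inputs: hLiu418 = `stmt-HodgeConjecture-24832`, h413 = `stmt-HodgeConjecture-24833`) until rung 0
closes; this file asserts no named fact and closes no socket; every head is CONDITIONAL on the EXPORTS₃ letters (E1)(E2)(E2-bd)(E4)[(E3)] (payer K2E1-p13 (101) ∕ K2E4-p14).
References: [MoeglinWaldspurger1995] IV.1.9–IV.1.11, II.1.7 · [Langlands1976] §6–§7 · [BernsteinLapid2019] §4 · [Conway1978] IV §3 (identity theorem).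
-/

set_option autoImplicit false
-- the mandated namespace repeats the single-problem summit's segment (`HodgeConjecture.HodgeConjecture`)
set_option linter.dupNamespace false

noncomputable section

open MeasureTheory Measure NumberField IsDedekindDomain Set Filter Topology
open scoped ENNReal NNReal
open Literature.NumberTheory.Automorphic Literature.NumberTheory.Automorphic.UnitaryGroup AdelicGroupData
open Summit.HodgeConjecture.HodgeConjecture.Cruxes.H413.K2E1BorelEisensteinU
open Summit.HodgeConjecture.HodgeConjecture.Cruxes.H413.K2E1SphericalEisensteinHeckeEigenU2 (hHecke_cm_three)
open Summit.HodgeConjecture.HodgeConjecture.Cruxes.H413.K2E1SphericalHeckeEigenSectionU2 (differentiable_integral_mul_borelHeight_cpow_cm continuous_borelHeight_cpow)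
open Summit.HodgeConjecture.HodgeConjecture.Cruxes.H413.K2E1SphericalEisensteinContinuationU3Final (borelConstantTerm_sphericalEisenstein_cm_three)
open Summit.HodgeConjecture.HodgeConjecture.Cruxes.HLiu418.K2LiuContinuedFamilyUnipotentIntegralsHolomorphic (differentiableOn_integral_mul_family)

namespace Summit.HodgeConjecture.HodgeConjecture.Cruxes.H413.K2E1ContinuedEisensteinHeckeConstantTermCMThree

variable (L : Type) [Field L] [NumberField L] [IsCMField L]
variable [MeasurableSpace (quasiSplit (↥(maximalRealSubfield L)) L (IsCMField.complexConj L) 3).Adelic] [BorelSpace (quasiSplit (↥(maximalRealSubfield L)) L (IsCMField.complexConj L) 3).Adelic]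

/-! ## §1 Holomorphy of the Hecke integral and of the constant term of the continued family -/

section Holomorphy

/-- **`z ↦ ∫ h(y)·Ẽ(z)(g y) dν_G(y)` IS HOLOMORPHIC ON `D`** for `h ∈ C_c(G(𝔸))` real, under (E1)(E4)(E2-bd) (★ `differentiableOn_integral_mul_family` with `a = (g·)`, `w = h`, `K = supp h`).
[cite: MoeglinWaldspurger1995, IV.1.9] [cite: Conway1978, IV §2] -/
theorem differentiableOn_integral_mul_continued_cm_three (νG : Measure (quasiSplit (↥(maximalRealSubfield L)) L (IsCMField.complexConj L) 3).Adelic) [IsFiniteMeasureOnCompacts νG]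
    {h : (quasiSplit (↥(maximalRealSubfield L)) L (IsCMField.complexConj L) 3).Adelic → ℝ} (hhc : Continuous h) (hhs : HasCompactSupport h)
    (Ec : ℂ → (quasiSplit (↥(maximalRealSubfield L)) L (IsCMField.complexConj L) 3).Adelic → ℂ) {D : Set ℂ} (hDo : IsOpen D)
    (hEd : ∀ g, DifferentiableOn ℂ (fun z => Ec z g) D) (hEc : ∀ z ∈ D, Continuous (Ec z))
    (hEbd : ∀ z₀ ∈ D, ∀ K : Set (quasiSplit (↥(maximalRealSubfield L)) L (IsCMField.complexConj L) 3).Adelic, IsCompact K →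
      ∃ V ∈ 𝓝 z₀, ∃ M : ℝ, ∀ z ∈ V, ∀ g ∈ K, ‖Ec z g‖ ≤ M)
    (g : (quasiSplit (↥(maximalRealSubfield L)) L (IsCMField.complexConj L) 3).Adelic) :
    DifferentiableOn ℂ (fun z => ∫ y, ((h y : ℝ) : ℂ) * Ec z (g * y) ∂νG) D := by
  have hw : Integrable (fun y => ((h y : ℝ) : ℂ)) νG :=
    (Complex.continuous_ofReal.comp hhc).integrable_of_hasCompactSupport (hhs.comp_left Complex.ofReal_zero)
  refine differentiableOn_integral_mul_family νG hDo Ec (fun y => hEd y) hEc (continuous_const.mul continuous_id) hw (K := tsupport h)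
    (fun y hy => by rw [image_eq_zero_of_notMem_tsupport hy, Complex.ofReal_zero]) fun z hz => ?_
  obtain ⟨V, hV, M, hM⟩ := hEbd z hz ((fun y => g * y) '' tsupport h) (hhs.isCompact.image (continuous_const.mul continuous_id))
  obtain ⟨R, hR, hRV⟩ := Metric.mem_nhds_iff.1 hV
  exact ⟨R, hR, M, fun s hs u hu => hM s (hRV (Metric.mem_ball.2 hs)) _ ⟨u, hu, rfl⟩⟩

/-- **`z ↦ Ẽ(z)_B(g)` IS HOLOMORPHIC ON `D`** (`ν` finite on the fundamental domain `𝓕` of compact closure; ★ brick on `ν|_𝓕` with the weight `𝟙_{closure 𝓕}` and `a(u) = u·g`).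
[cite: MoeglinWaldspurger1995, IV.1.9, II.1.7] -/
theorem differentiableOn_borelConstantTerm_continued_cm_three
    (ν : Measure ↥(adelicUnipotent (↥(maximalRealSubfield L)) L (IsCMField.complexConj L) 3)) {𝓕 : Set ↥(adelicUnipotent (↥(maximalRealSubfield L)) L (IsCMField.complexConj L) 3)}
    (h𝓕m : NullMeasurableSet 𝓕 ν) (h𝓕top : ν 𝓕 ≠ ∞) (h𝓕c : IsCompact (closure 𝓕))
    (Ec : ℂ → (quasiSplit (↥(maximalRealSubfield L)) L (IsCMField.complexConj L) 3).Adelic → ℂ) {D : Set ℂ} (hDo : IsOpen D)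
    (hEd : ∀ g, DifferentiableOn ℂ (fun z => Ec z g) D) (hEc : ∀ z ∈ D, Continuous (Ec z))
    (hEbd : ∀ z₀ ∈ D, ∀ K : Set (quasiSplit (↥(maximalRealSubfield L)) L (IsCMField.complexConj L) 3).Adelic, IsCompact K →
      ∃ V ∈ 𝓝 z₀, ∃ M : ℝ, ∀ z ∈ V, ∀ g ∈ K, ‖Ec z g‖ ≤ M)
    (g : (quasiSplit (↥(maximalRealSubfield L)) L (IsCMField.complexConj L) 3).Adelic) :
    DifferentiableOn ℂ (fun z => borelConstantTerm ν 𝓕 (Ec z) g) D := by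
  haveI : IsFiniteMeasure (ν.restrict 𝓕) := isFiniteMeasure_restrict.2 h𝓕top
  set w : ↥(adelicUnipotent (↥(maximalRealSubfield L)) L (IsCMField.complexConj L) 3) → ℂ := (closure 𝓕).indicator fun _ => (1 : ℂ) with hw_def
  have hw : Integrable w (ν.restrict 𝓕) := (integrable_const (1 : ℂ)).indicator isClosed_closure.measurableSet
  have ha : Continuous fun u : ↥(adelicUnipotent (↥(maximalRealSubfield L)) L (IsCMField.complexConj L) 3) =>
      (u : (quasiSplit (↥(maximalRealSubfield L)) L (IsCMField.complexConj L) 3).Adelic) * g := continuous_subtype_val.mul continuous_const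
  have hdiff := differentiableOn_integral_mul_family (ν.restrict 𝓕) hDo Ec (fun y => hEd y) hEc ha hw (K := closure 𝓕)
    (fun u hu => Set.indicator_of_notMem hu _) fun z hz => by
      obtain ⟨V, hV, M, hM⟩ := hEbd z hz _ (h𝓕c.image ha)
      obtain ⟨R, hR, hRV⟩ := Metric.mem_nhds_iff.1 hV
      exact ⟨R, hR, M, fun s hs u hu => hM s (hRV (Metric.mem_ball.2 hs)) _ ⟨u, hu, rfl⟩⟩
  -- `Ẽ(z)_B(g) = ν(𝓕)⁻¹ • ∫ w · Ẽ(z)(u g) d(ν|_𝓕)`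
  have heq : ∀ z, borelConstantTerm ν 𝓕 (Ec z) g = ((ν 𝓕).toReal⁻¹ : ℝ) • ∫ u, w u * Ec z ((u : (quasiSplit (↥(maximalRealSubfield L)) L (IsCMField.complexConj L) 3).Adelic) * g) ∂(ν.restrict 𝓕) := fun z => by
    rw [borelConstantTerm_def]
    congr 1
    refine integral_congr_ae ?_
    filter_upwards [ae_restrict_mem₀ h𝓕m] with u hu
    rw [hw_def, Set.indicator_of_mem (subset_closure hu), one_mul]
  have hfun : (fun z => borelConstantTerm ν 𝓕 (Ec z) g) =
      fun z => ((ν 𝓕).toReal⁻¹ : ℝ) • ∫ u, w u * Ec z ((u : (quasiSplit (↥(maximalRealSubfield L)) L (IsCMField.complexConj L) 3).Adelic) * g) ∂(ν.restrict 𝓕) := funext heq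
  rw [hfun]
  exact hdiff.const_smul ((ν 𝓕).toReal⁻¹ : ℝ)

end Holomorphy

/-! ## §2 (Hk) continued: `∫ h(y)·Ẽ(z)(g y) dν_G = ĥ(z)·Ẽ(z)(g)` on all of `D` -/

section Hecke

/-- **(Hk) CONTINUED — THE HECKE RELATION OF THE CONTINUED EISENSTEIN SERIES ON THE WHOLE DOMAIN OF HOLOMORPHY.**  For `h` real, continuous, compactly supported and left-`K_U`-invariant, a
Haar measure `ν_G`, and continued values `Ẽ` on an open preconnected `D` containing a neighbourhood of a real tube point `σ₀ > 2`, with (E1)(E4)(E2-bd) and the tube agreement (E2):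
`∫ h(y)·Ẽ(z)(g y) dν_G(y) = ĥ(z)·Ẽ(z)(g)` for every `z ∈ D` and `g`, `ĥ(z) = ∫ h(x)H(x)^z dν_G` — both sides are holomorphic on `D` (§1; ★ `ĥ` entire) and agree near `σ₀` (★
`hHecke_cm_three`). [cite: MoeglinWaldspurger1995, IV.1.9–IV.1.10] [cite: Langlands1976, §6 p. 167] [cite: BernsteinLapid2019, §4 (Claim 1(a))] -/
theorem integral_mul_continued_eq_cm_three (νG : Measure (quasiSplit (↥(maximalRealSubfield L)) L (IsCMField.complexConj L) 3).Adelic) [νG.IsHaarMeasure]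
    {h : (quasiSplit (↥(maximalRealSubfield L)) L (IsCMField.complexConj L) 3).Adelic → ℝ}
    (hK : ∀ k : (quasiSplit (↥(maximalRealSubfield L)) L (IsCMField.complexConj L) 3).Adelic,
      adelicVal (↥(maximalRealSubfield L)) L (IsCMField.complexConj L) 3 ((StdForm.antidiagonal 3).over L) k ∈ standardMaximalCompactGL 3 L → ∀ x, h (k * x) = h x)
    (hhc : Continuous h) (hhs : HasCompactSupport h) (φ₀ : ℂ)
    (Ec : ℂ → (quasiSplit (↥(maximalRealSubfield L)) L (IsCMField.complexConj L) 3).Adelic → ℂ) {D : Set ℂ} (hDo : IsOpen D) (hDc : IsPreconnected D)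
    {σ₀ : ℝ} (hσ₀ : 2 < σ₀) (hσD : ∀ᶠ z in 𝓝 ((σ₀ : ℝ) : ℂ), z ∈ D)
    (hEd : ∀ g, DifferentiableOn ℂ (fun z => Ec z g) D) (hEc : ∀ z ∈ D, Continuous (Ec z))
    (hEbd : ∀ z₀ ∈ D, ∀ K : Set (quasiSplit (↥(maximalRealSubfield L)) L (IsCMField.complexConj L) 3).Adelic, IsCompact K →
      ∃ V ∈ 𝓝 z₀, ∃ M : ℝ, ∀ z ∈ V, ∀ g ∈ K, ‖Ec z g‖ ≤ M)
    (hE2 : ∀ z ∈ D, 2 < z.re → Ec z = eisensteinSeriesU (flatSectionU (fun _ : (quasiSplit (↥(maximalRealSubfield L)) L (IsCMField.complexConj L) 3).Adelic => φ₀) z)) :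
    ∀ z ∈ D, ∀ g : (quasiSplit (↥(maximalRealSubfield L)) L (IsCMField.complexConj L) 3).Adelic,
      ∫ y, ((h y : ℝ) : ℂ) * Ec z (g * y) ∂νG = (∫ x, ((h x : ℝ) : ℂ) * (((borelHeight x : ℝ≥0) : ℝ) : ℂ) ^ z ∂νG) * Ec z g := by
  intro z hz g
  -- the difference of the two sides is holomorphic on `D` and vanishes near `σ₀`
  set G : ℂ → ℂ := fun s => ∫ y, ((h y : ℝ) : ℂ) * Ec s (g * y) ∂νG - (∫ x, ((h x : ℝ) : ℂ) * (((borelHeight x : ℝ≥0) : ℝ) : ℂ) ^ s ∂νG) * Ec s g with hG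
  have hhat : Differentiable ℂ fun s : ℂ => ∫ x, ((h x : ℝ) : ℂ) * (((borelHeight x : ℝ≥0) : ℝ) : ℂ) ^ s ∂νG :=
    differentiable_integral_mul_borelHeight_cpow_cm L νG (Complex.continuous_ofReal.comp hhc) (hhs.comp_left Complex.ofReal_zero)
  have hGd : DifferentiableOn ℂ G D :=
    (differentiableOn_integral_mul_continued_cm_three L νG hhc hhs Ec hDo hEd hEc hEbd g).sub (hhat.differentiableOn.mul (hEd g))
  obtain ⟨ε, hε, hball⟩ := Metric.eventually_nhds_iff_ball.1 hσD
  have hσ₀D : ((σ₀ : ℝ) : ℂ) ∈ D := hball _ (Metric.mem_ball_self hε)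
  have hseed : G =ᶠ[𝓝 ((σ₀ : ℝ) : ℂ)] 0 := by
    have hmem : Metric.ball ((σ₀ : ℝ) : ℂ) (min ε (σ₀ - 2)) ∈ 𝓝 ((σ₀ : ℝ) : ℂ) := Metric.ball_mem_nhds _ (lt_min hε (by linarith))
    filter_upwards [hmem] with s hs
    rw [Metric.mem_ball] at hs
    have hsD : s ∈ D := hball _ (Metric.mem_ball.2 (hs.trans_le (min_le_left _ _)))
    have hs2 : 2 < s.re := by
      have h1 : |s.re - σ₀| ≤ dist s ((σ₀ : ℝ) : ℂ) := by
        rw [Complex.dist_eq]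
        simpa only [Complex.sub_re, Complex.ofReal_re] using Complex.abs_re_le_norm (s - ((σ₀ : ℝ) : ℂ))
      have h2 := (abs_lt.1 (h1.trans_lt (hs.trans_le (min_le_right _ _)))).1
      linarith
    show G s = (0 : ℂ → ℂ) s
    rw [Pi.zero_apply, hG]
    change ∫ y, ((h y : ℝ) : ℂ) * Ec s (g * y) ∂νG - (∫ x, ((h x : ℝ) : ℂ) * (((borelHeight x : ℝ≥0) : ℝ) : ℂ) ^ s ∂νG) * Ec s g = 0
    rw [hE2 s hsD hs2, hHecke_cm_three L νG hK hhc hhs φ₀ s hs2 g, sub_self]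
  have h0 := (hGd.analyticOnNhd hDo).eqOn_zero_of_preconnected_of_eventuallyEq_zero hDc hσ₀D hseed hz
  rw [Pi.zero_apply, hG] at h0
  exact sub_eq_zero.1 h0

end Hecke

/-! ## §3 (E3′) continued: `Ẽ(z)_B(g) = φ₀(H(g)^z + c̃(z)H(g)^{2−z})` on all of `D` -/

section ConstantTerm

/-- **(E3′) CONTINUED — THE CONSTANT TERM OF THE CONTINUED EISENSTEIN SERIES ON THE WHOLE DOMAIN OF HOLOMORPHY, AT EVERY POINT.**  For `ν` Haar on `N(𝔸)` with a fundamental domain `𝓕`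
of `N(L⁺)` of compact closure, continued values `Ẽ` on an open preconnected `D` (neighbourhood of a real tube point `σ₀ > 2` inside) with (E1)(E4)(E2-bd)(E2), and a coefficient `c̃`
holomorphic on `D` satisfying the tube identity (E3) `E(φ₀H^z)_B(g) = φ₀(H(g)^z + c̃(z)H(g)^{2−z})` (`2 < Re z`, `z ∈ D`; ★ `borelConstantTerm_sphericalEisenstein_cm_three` names the
coefficient): `Ẽ(z)_B(g) = φ₀·(H(g)^z + c̃(z)·H(g)^{2−z})` for EVERY `z ∈ D` and `g` (§1 holomorphy + identity principle). [cite: MoeglinWaldspurger1995, IV.1.9–IV.1.11, II.1.7] [cite: Langlands1976, §7] -/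
theorem borelConstantTerm_continued_eq_cm_three
    (ν : Measure ↥(adelicUnipotent (↥(maximalRealSubfield L)) L (IsCMField.complexConj L) 3)) [ν.IsHaarMeasure]
    {𝓕 : Set ↥(adelicUnipotent (↥(maximalRealSubfield L)) L (IsCMField.complexConj L) 3)}
    (h𝓕N : IsFundamentalDomain ↥(rationalUnipotent (↥(maximalRealSubfield L)) L (IsCMField.complexConj L) 3) 𝓕 ν) (h𝓕c : IsCompact (closure 𝓕)) (φ₀ : ℂ)
    (Ec : ℂ → (quasiSplit (↥(maximalRealSubfield L)) L (IsCMField.complexConj L) 3).Adelic → ℂ) {D : Set ℂ} (hDo : IsOpen D) (hDc : IsPreconnected D)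
    {σ₀ : ℝ} (hσ₀ : 2 < σ₀) (hσD : ∀ᶠ z in 𝓝 ((σ₀ : ℝ) : ℂ), z ∈ D)
    (hEd : ∀ g, DifferentiableOn ℂ (fun z => Ec z g) D) (hEc : ∀ z ∈ D, Continuous (Ec z))
    (hEbd : ∀ z₀ ∈ D, ∀ K : Set (quasiSplit (↥(maximalRealSubfield L)) L (IsCMField.complexConj L) 3).Adelic, IsCompact K →
      ∃ V ∈ 𝓝 z₀, ∃ M : ℝ, ∀ z ∈ V, ∀ g ∈ K, ‖Ec z g‖ ≤ M)
    (hE2 : ∀ z ∈ D, 2 < z.re → Ec z = eisensteinSeriesU (flatSectionU (fun _ : (quasiSplit (↥(maximalRealSubfield L)) L (IsCMField.complexConj L) 3).Adelic => φ₀) z))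
    {cc : ℂ → ℂ} (hcc : DifferentiableOn ℂ cc D)
    (hccE : ∀ z ∈ D, 2 < z.re → ∀ g : (quasiSplit (↥(maximalRealSubfield L)) L (IsCMField.complexConj L) 3).Adelic,
      borelConstantTerm ν 𝓕 (eisensteinSeriesU (flatSectionU (fun _ : (quasiSplit (↥(maximalRealSubfield L)) L (IsCMField.complexConj L) 3).Adelic => φ₀) z)) g =
        φ₀ * ((((borelHeight g : ℝ≥0) : ℝ) : ℂ) ^ z + cc z * (((borelHeight g : ℝ≥0) : ℝ) : ℂ) ^ (2 - z))) :
    ∀ z ∈ D, ∀ g : (quasiSplit (↥(maximalRealSubfield L)) L (IsCMField.complexConj L) 3).Adelic,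
      borelConstantTerm ν 𝓕 (Ec z) g = φ₀ * ((((borelHeight g : ℝ≥0) : ℝ) : ℂ) ^ z + cc z * (((borelHeight g : ℝ≥0) : ℝ) : ℂ) ^ (2 - z)) := by
  intro z hz g
  have h𝓕top : ν 𝓕 ≠ ∞ := ((measure_mono subset_closure).trans_lt h𝓕c.measure_lt_top).ne
  set G : ℂ → ℂ := fun s => borelConstantTerm ν 𝓕 (Ec s) g - φ₀ * ((((borelHeight g : ℝ≥0) : ℝ) : ℂ) ^ s + cc s * (((borelHeight g : ℝ≥0) : ℝ) : ℂ) ^ (2 - s)) with hG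
  -- `s ↦ H(g)^s`, `s ↦ H(g)^{2−s}` are entire (`H(g) > 0`)
  have hH : (((borelHeight g : ℝ≥0) : ℝ) : ℂ) ∈ Complex.slitPlane :=
    Complex.ofReal_mem_slitPlane.2 (NNReal.coe_pos.2 (borelHeight_pos g))
  have hp1 : Differentiable ℂ fun s : ℂ => (((borelHeight g : ℝ≥0) : ℝ) : ℂ) ^ s := fun s => differentiableAt_id.const_cpow (Or.inl (Complex.slitPlane_ne_zero hH))
  have hp2 : Differentiable ℂ fun s : ℂ => (((borelHeight g : ℝ≥0) : ℝ) : ℂ) ^ (2 - s) := fun s =>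
    ((differentiableAt_const (2 : ℂ)).sub differentiableAt_id).const_cpow (Or.inl (Complex.slitPlane_ne_zero hH))
  have hGd : DifferentiableOn ℂ G D :=
    (differentiableOn_borelConstantTerm_continued_cm_three L ν h𝓕N.nullMeasurableSet h𝓕top h𝓕c Ec hDo hEd hEc hEbd g).sub
      ((hp1.differentiableOn.add (hcc.mul hp2.differentiableOn)).const_mul φ₀)
  obtain ⟨ε, hε, hball⟩ := Metric.eventually_nhds_iff_ball.1 hσD
  have hσ₀D : ((σ₀ : ℝ) : ℂ) ∈ D := hball _ (Metric.mem_ball_self hε)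
  have hseed : G =ᶠ[𝓝 ((σ₀ : ℝ) : ℂ)] 0 := by
    have hmem : Metric.ball ((σ₀ : ℝ) : ℂ) (min ε (σ₀ - 2)) ∈ 𝓝 ((σ₀ : ℝ) : ℂ) := Metric.ball_mem_nhds _ (lt_min hε (by linarith))
    filter_upwards [hmem] with s hs
    rw [Metric.mem_ball] at hs
    have hsD : s ∈ D := hball _ (Metric.mem_ball.2 (hs.trans_le (min_le_left _ _)))
    have hs2 : 2 < s.re := by
      have h1 : |s.re - σ₀| ≤ dist s ((σ₀ : ℝ) : ℂ) := by
        rw [Complex.dist_eq]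
        simpa only [Complex.sub_re, Complex.ofReal_re] using Complex.abs_re_le_norm (s - ((σ₀ : ℝ) : ℂ))
      have h2 := (abs_lt.1 (h1.trans_lt (hs.trans_le (min_le_right _ _)))).1
      linarith
    show G s = (0 : ℂ → ℂ) s
    rw [Pi.zero_apply, hG]
    change borelConstantTerm ν 𝓕 (Ec s) g - φ₀ * ((((borelHeight g : ℝ≥0) : ℝ) : ℂ) ^ s + cc s * (((borelHeight g : ℝ≥0) : ℝ) : ℂ) ^ (2 - s)) = 0
    rw [hE2 s hsD hs2, hccE s hsD hs2 g, sub_self]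
  have h0 := (hGd.analyticOnNhd hDo).eqOn_zero_of_preconnected_of_eventuallyEq_zero hDc hσ₀D hseed hz
  rw [Pi.zero_apply, hG] at h0
  exact sub_eq_zero.1 h0

end ConstantTerm

end Summit.HodgeConjecture.HodgeConjecture.Cruxes.H413.K2E1ContinuedEisensteinHeckeConstantTermCMThree

end
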